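import Mathlib.LinearAlgebra.RootSystem.Finite.Nondegenerate
import Mathlib.LinearAlgebra.RootSystem.CartanMatrix
import Literature.NumberTheory.Automorphic.LieGraphCommutant
import Literature.NumberTheory.Automorphic.StableSubspaceDet
import Literature.NumberTheory.Automorphic.RootDataReducedHolds
import Literature.NumberTheory.Automorphic.ChevalleyGroupLie
import HarnessLib

/-!
# `Lie(T) = 𝔷 + ∑ k h_α` and the centre of `Lie(G)` is detected by traces on stable subspaces
(trunk T-AUTOMORPHIC, G25 AutomorphicL; tool for the graph proof of `chevalley_isomorphism(_abstract)`,
Springer 9.6.2; the `k`-points substitute for Springer 8.1.8 `T = R(G) · T₁`)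

Let `(G, T)` be connected reductive with root datum `P` over an algebraically closed field of
characteristic `0` (`h : IsRootDatumOf G T P eX eY`), `h_i = h.rootH i` the coroot vectors in
`Lie(T)` and `dχ_x` the differentials of the characters (`dChar`, `TorusLieDual.lean`).

* **`cartanMatrix_det_ne_zero`** — for a base `b` of `P` (over `ℤ`, `RootPairing.nonempty_base_int`)
  the Cartan matrix `(⟨α_i, α_j^∨⟩)_{i,j ∈ b}` has non-zero determinant: if `x = ∑ v_i α_i` pairs to
  zero with every simple coroot it pairs to zero with every coroot, hence `x = 0` by the
  non-degeneracy of the root form over the ordered ring `ℤ` (Mathlib `RootPairing.exists_coroot_ne`),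
  and `v = 0` by the linear independence of the simple roots;
* **`exists_coeff_forall_root`** — consequently every additive `φ : X → k` agrees on the roots with a
  `k`-combination of the simple coroots: `φ (α_l) = ∑_j c_j ⟨α_l, α_j^∨⟩` (solve the Cartan system in
  `k`, `det ≠ 0` surviving in characteristic `0`, and extend from simple roots to roots by
  `ℤ`-linearity);
* **`exists_sub_mem_torusCenter`** — `Lie(T) = 𝔷 + ∑_j k h_j` where
  `torusCenter = 𝔷 = {Z ∈ Lie(T) | dα(Z) = 0 for all roots α}` (apply the previous point to
  `φ = (x ↦ dχ_x (H))`, `dχ_x (h_j) = ⟨x, α_j^∨⟩`); elements of `𝔷` commute with `G`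
  (`forall_mul_eq_mul_of_mem_torusCenter`);
* **`eq_zero_of_mem_torusCenter_of_forall_trace`** — an element of `𝔷` whose trace vanishes on every
  `G`-stable subspace is `0` (its eigenspaces are `G`-stable and it is diagonalisable);
* **`mem_span_rootH_of_forall_trace_eq_zero`** — hence an `H ∈ Lie(T)` with `tr (H|_W) = 0` for every
  `G`-stable `W` lies in `∑ k h_j` (the `h_j = [e_j, f_j]` themselves have this property,
  `trace_restrMat_lie_eq_zero`).

Everything is proved; no named fact is introduced.

## Mathlib / Literature

Searched `cartanMatrix`, `Nondegenerate`, `corootForm`, `eigenspace` + `commute`, `torusCenter`: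
`cartanMatrix_det_ne_zero` generalises `RootDatumBaseChange.cartanMatrix_nondegenerate_int` (which is
the `Matrix.Nondegenerate` form and additionally assumes `[Module.Finite ℤ X]`; ours is the direct
20-line argument with no base change, so that the old statement can be derived from it);
`exists_coeff_support` is the Cartan-system solution of `ChevalleyGroupLie.exists_corootForm_combination`
reformulated for additive functionals `X → k` and indexed by `b.support` (kept as an auxiliary step of
`exists_coeff_forall_root`, cross-referenced here); Mathlib's `RootPairing.Base.cartanMatrix_nondegenerate`
needs `IsRootSystem` (the roots spanning), which fails for root data of reductive groups, so a
datum-level statement is genuinely needed. Eigenspaces are Mathlib's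
`Module.End.eigenspace (Matrix.toLin' Z) c`, their stability under commuting matrices is the tree's
`RootRep.toLin'_mem_eigenspace_of_commute` (`ChevalleyGroupLie.lean`).

## References

* [SpringerLAG1998] T. A. Springer, *Linear Algebraic Groups*, 2nd ed. (1998), 7.1.1, 8.1.8, 8.1.11.
* [Humphreys1972] J. E. Humphreys, *Introduction to Lie Algebras and Representation Theory* (1972), §8.5, §11.1.
-/

noncomputable section

open scoped MatrixGroups IsMulCommutative
open Set

namespace Literature.NumberTheory.Automorphic

/-! ### The Cartan matrix of a base of a root datum is non-singular -/

section Cartan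

variable {ι X Y : Type*} [AddCommGroup X] [AddCommGroup Y] [Fintype ι] [DecidableEq ι] {P : RootPairing ι ℤ X Y}

omit [Fintype ι] [DecidableEq ι] in
/-- `x ∈ X` pairing to zero with all simple coroots pairs to zero with all coroots. [folklore] -/
lemma coroot'_eq_zero_of_forall_support (b : P.Base) {x : X} (hx : ∀ j ∈ b.support, P.coroot' j x = 0)
    (l : ι) : P.coroot' l x = 0 := by
  have key : ∀ y ∈ Submodule.span ℤ (P.coroot '' (b.support : Set ι)), P.toLinearMap x y = 0 := by
    intro y hy
    induction hy using Submodule.span_induction with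
    | mem y hy =>
      obtain ⟨j, hj, rfl⟩ := hy
      exact hx j hj
    | zero => simp
    | add y z _ _ hy hz => simp [hy, hz]
    | smul a y _ hy => simp [hy]
  exact key _ (b.coroot_mem_span_int l)

omit [DecidableEq ι] in
/-- A `ℤ`-combination of roots pairing to zero with every coroot is zero (non-degeneracy of the root
form over the ordered ring `ℤ`). [cite: Humphreys1972, 8.5] -/
lemma eq_zero_of_mem_rootSpan_of_forall_coroot' {x : X} (hxmem : x ∈ P.rootSpan ℤ)
    (hx : ∀ l, P.coroot' l x = 0) : x = 0 := by
  by_contra hne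
  obtain ⟨l, hl⟩ := RootPairing.exists_coroot_ne (P := P) ℤ (x := ⟨x, hxmem⟩)
    (fun h0 => hne (congrArg Subtype.val h0))
  apply hl
  have e := RootPairing.algebraMap_coroot'In_apply (P := P) ℤ l ⟨x, hxmem⟩
  simp only [Algebra.algebraMap_self, RingHom.id_apply] at e
  rw [e]
  exact hx l

/-- **The Cartan matrix of a base is non-singular** (over `ℤ`, for any finite root datum; generalises
`cartanMatrix_nondegenerate_int` of `RootDatumBaseChange.lean`, dropping `[Module.Finite ℤ X]`).
[cite: Humphreys1972, 11.1] -/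
theorem cartanMatrix_det_ne_zero (b : P.Base) : b.cartanMatrix.det ≠ 0 := by
  classical
  intro hdet
  obtain ⟨v, hv0, hv⟩ := Matrix.exists_vecMul_eq_zero_iff.2 hdet
  apply hv0
  set x : X := ∑ i : ↥b.support, v i • P.root i with hx
  -- `⟨x, α_j^∨⟩ = (v ᵥ* C) j = 0` for simple `j`
  have hxj : ∀ j ∈ b.support, P.coroot' j x = 0 := by
    intro j hj
    have h := congrFun hv ⟨j, hj⟩
    rw [Pi.zero_apply, Matrix.vecMul, dotProduct] at h
    rw [hx, map_sum, ← h]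
    refine Finset.sum_congr rfl fun i _ => ?_
    rw [map_zsmul, RootPairing.root_coroot'_eq_pairing, smul_eq_mul]
    congr 1
    have e := RootPairing.algebraMap_pairingIn P ℤ (i : ι) j
    simp only [Algebra.algebraMap_self, RingHom.id_apply] at e
    rw [RootPairing.Base.cartanMatrix, RootPairing.Base.cartanMatrixIn_def, e]
  have hxmem : x ∈ P.rootSpan ℤ :=
    Submodule.sum_mem _ fun i _ => Submodule.smul_mem _ _ (Submodule.subset_span ⟨(i : ι), rfl⟩)
  have hx0 : x = 0 :=
    eq_zero_of_mem_rootSpan_of_forall_coroot' (P := P) hxmem (coroot'_eq_zero_of_forall_support b hxj)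
  rw [hx] at hx0
  exact funext (Fintype.linearIndependent_iff.1 b.linearIndepOn_root v hx0)

variable {k : Type*} [Field k] [CharZero k]

/-- **Solving the Cartan system in `k`** (auxiliary; cf. `exists_corootForm_combination` of
`ChevalleyGroupLie.lean`, the same solution packaged through `corootForm`): for every `r : b → k`
there are `c_j ∈ k` with `∑_j c_j ⟨α_i, α_j^∨⟩ = r_i` for all simple `i` (the determinant survives in
characteristic `0`). [folklore] -/
theorem exists_coeff_support (b : P.Base) (r : ↥b.support → k) :
    ∃ c : ↥b.support → k, ∀ i : ↥b.support, ∑ j, c j * ((P.pairing i j : ℤ) : k) = r i := by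
  classical
  set C : Matrix ↥b.support ↥b.support k := b.cartanMatrix.map (Int.cast : ℤ → k) with hC
  have hdet : C.det ≠ 0 := by
    rw [hC, show (Int.cast : ℤ → k) = (Int.castRingHom k : ℤ → k) from rfl, ← RingHom.mapMatrix_apply,
      ← RingHom.map_det, eq_intCast]
    exact Int.cast_ne_zero.2 (cartanMatrix_det_ne_zero b)
  have hunit : IsUnit C.det := isUnit_iff_ne_zero.2 hdet
  refine ⟨C⁻¹.mulVec r, fun i => ?_⟩
  have h := congrFun (Matrix.mulVec_mulVec r C C⁻¹) i
  rw [Matrix.mul_nonsing_inv _ hunit, Matrix.one_mulVec] at h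
  rw [← h, Matrix.mulVec, dotProduct]
  refine Finset.sum_congr rfl fun j _ => ?_
  rw [mul_comm]
  congr 1
  have e := RootPairing.algebraMap_pairingIn P ℤ (i : ι) (j : ι)
  simp only [Algebra.algebraMap_self, RingHom.id_apply] at e
  rw [hC, Matrix.map_apply, RootPairing.Base.cartanMatrix, RootPairing.Base.cartanMatrixIn_def, e]

/-- **Every additive `φ : X → k` agrees on the roots with a `k`-combination of simple coroots**:
`φ (α_l) = ∑_j c_j ⟨α_l, α_j^∨⟩`. [cite: SpringerLAG1998, 8.1.8] -/
theorem exists_coeff_forall_root (b : P.Base) (φ : X →+ k) :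
    ∃ c : ↥b.support → k, ∀ l : ι, φ (P.root l) = ∑ j, c j * ((P.pairing l j : ℤ) : k) := by
  classical
  obtain ⟨c, hc⟩ := exists_coeff_support b (fun i => φ (P.root i))
  refine ⟨c, fun l => ?_⟩
  -- `φ' = φ - ∑ c_j ⟨·, α_j^∨⟩` kills the simple roots, hence all roots
  let ψ : X →+ k := φ - ∑ j, c j • ((Int.castAddHom k).comp (P.coroot' (j : ι)).toAddMonoidHom)
  have hψ : ∀ x, ψ x = φ x - ∑ j, c j * ((P.coroot' (j : ι) x : ℤ) : k) := by
    intro x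
    simp [ψ, AddMonoidHom.sub_apply]
  have hψs : ∀ i ∈ b.support, ψ (P.root i) = 0 := by
    intro i hi
    rw [hψ, sub_eq_zero, ← hc ⟨i, hi⟩]
    refine Finset.sum_congr rfl fun j _ => ?_
    rw [RootPairing.root_coroot'_eq_pairing]
  have key : ∀ y ∈ Submodule.span ℤ (P.root '' (b.support : Set ι)), ψ.toIntLinearMap y = 0 := by
    intro y hy
    induction hy using Submodule.span_induction with
    | mem y hy =>
      obtain ⟨i, hi, rfl⟩ := hy
      exact hψs i hi
    | zero => simp
    | add y z _ _ hy hz => rw [map_add, hy, hz, add_zero]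
    | smul a y _ hy => rw [map_smul, hy, smul_zero]
  have h0 := key _ (b.root_mem_span_int l)
  rw [AddMonoidHom.coe_toIntLinearMap, hψ, sub_eq_zero] at h0
  rw [h0]
  refine Finset.sum_congr rfl fun j _ => ?_
  rw [RootPairing.root_coroot'_eq_pairing]

end Cartan

/-! ### `Lie(T) = 𝔷 + ∑ k h_j` -/

section Torus

variable {k : Type*} [Field k] [IsAlgClosed k] [CharZero k] {n : Type*} [Fintype n] [DecidableEq n]
variable {ι X Y : Type*} [AddCommGroup X] [AddCommGroup Y] [Fintype ι] [DecidableEq ι]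
variable {G T : Subgroup (GL n k)} [IsMulCommutative ↥T]
variable {P : RootPairing ι ℤ X Y} {eX : Additive ↥(characterLattice T) ≃+ X}
  {eY : Additive ↥(cocharacterLattice T) ≃+ Y}
variable (hG : IsConnectedReductive G) (hT : IsMaximalTorusIn T G) (h : IsRootDatumOf G T P eX eY)

/-- **The centre part `𝔷 = {Z ∈ Lie(T) | dα(Z) = 0 for all roots α}`** of `Lie(T)`. [folklore] -/
def torusCenter (T : Subgroup (GL n k)) [IsMulCommutative ↥T] (eX : Additive ↥(characterLattice T) ≃+ X)
    (P : RootPairing ι ℤ X Y) : Submodule k (Matrix n n k) where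
  carrier := {Z | Z ∈ lieAlgebraGL T ∧ ∀ l : ι, dChar (Additive.toMul (eX.symm (P.root l))) Z = 0}
  zero_mem' := ⟨Submodule.zero_mem _, fun l => map_zero _⟩
  add_mem' := fun {a b} ha hb => ⟨Submodule.add_mem _ ha.1 hb.1, fun l => by rw [map_add, ha.2 l, hb.2 l, add_zero]⟩
  smul_mem' := fun c {a} ha => ⟨Submodule.smul_mem _ c ha.1, fun l => by rw [map_smul, ha.2 l, smul_zero]⟩

omit [IsAlgClosed k] [CharZero k] [Fintype ι] [DecidableEq ι] in
/-- Membership in `torusCenter`. [folklore] -/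
lemma mem_torusCenter_iff {Z : Matrix n n k} :
    Z ∈ torusCenter T eX P ↔ Z ∈ lieAlgebraGL T ∧ ∀ l : ι, dChar (Additive.toMul (eX.symm (P.root l))) Z = 0 :=
  Iff.rfl

include h in
omit [CharZero k] [Fintype ι] [DecidableEq ι] in
/-- Elements of `𝔷` commute with every root vector. [folklore] -/
lemma mul_rootE_eq_of_mem_torusCenter {Z : Matrix n n k} (hZ : Z ∈ torusCenter T eX P) (l : ι) :
    Z * h.rootE l = h.rootE l * Z := by
  haveI : Infinite k := IsAlgClosed.instInfinite
  have e := lie_eq_dChar_smul (Additive.toMul (eX.symm (P.root l))) (h.rootE_mem l).2 hZ.1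
  rw [hZ.2 l, zero_smul, sub_eq_zero] at e
  exact e

include hG hT h in
omit [Fintype ι] [DecidableEq ι] in
/-- **Elements of `𝔷` commute with `G`.** [cite: SpringerLAG1998, 8.1.8] -/
theorem forall_mul_eq_mul_of_mem_torusCenter {Z : Matrix n n k} (hZ : Z ∈ torusCenter T eX P) :
    ∀ g ∈ G, ((g : GL n k) : Matrix n n k) * Z = Z * g :=
  forall_mul_eq_mul_of_central hG hT h hZ.1 (mul_rootE_eq_of_mem_torusCenter h hZ)

include h in
omit [CharZero k] [Fintype ι] [DecidableEq ι] in
/-- `dχ_x (h_j) = ⟨x, α_j^∨⟩`. [cite: SpringerLAG1998, 3.2.11] -/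
lemma dChar_rootH (x : X) (j : ι) :
    dChar (Additive.toMul (eX.symm x)) (h.rootH j) = ((P.toLinearMap x (P.coroot j) : ℤ) : k) :=
  h.tangentDeriv_rootH j x (dChar_choose_spec (Additive.toMul (eX.symm x)))

include hG hT h in
/-- **`Lie(T) = 𝔷 + ∑_j k h_j`**: every `H ∈ Lie(T)` differs from a `k`-combination of finitely many
coroot vectors `h_j` (those of the support of a base of `P`) by an element of `𝔷`.
[cite: SpringerLAG1998, 8.1.8] -/
theorem exists_sub_mem_torusCenter {H : Matrix n n k} (hH : H ∈ lieAlgebraGL T) :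
    ∃ (s : Finset ι) (c : ι → k), H - ∑ j ∈ s, c j • h.rootH j ∈ torusCenter T eX P := by
  classical
  haveI : P.IsReduced := isReduced_of_isRootDatumOf_holds hG hT h
  obtain ⟨b⟩ := P.nonempty_base_int
  -- the functional `x ↦ dχ_x (H)`
  let φ : X →+ k := (lieTorusDual T ⟨H, hH⟩).comp eX.symm.toAddMonoidHom
  have hφ : ∀ x, φ x = dChar (Additive.toMul (eX.symm x)) H := fun x => rfl
  obtain ⟨c, hc⟩ := exists_coeff_forall_root (k := k) b φ
  -- extend `c` by zero outside the base
  let c' : ι → k := fun j => if hj : j ∈ b.support then c ⟨j, hj⟩ else 0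
  have hsum : ∑ j ∈ b.support, c' j • h.rootH j = ∑ j : ↥b.support, c j • h.rootH j := by
    rw [← Finset.sum_attach]
    refine Finset.sum_congr rfl fun j _ => ?_
    simp [c', j.2]
  refine ⟨b.support, c', ?_⟩
  rw [hsum, mem_torusCenter_iff]
  refine ⟨Submodule.sub_mem _ hH (Submodule.sum_mem _ fun j _ =>
    Submodule.smul_mem _ _ (h.rootH_mem_lieAlgebraGL j)), fun l => ?_⟩
  rw [map_sub, map_sum, ← hφ, hc l, sub_eq_zero]
  refine Finset.sum_congr rfl fun j _ => ?_
  rw [map_smul, dChar_rootH h, smul_eq_mul, RootPairing.root_coroot_eq_pairing]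

end Torus

/-! ### The centre is detected by traces on stable subspaces -/

section Traces

variable {k : Type*} [Field k] [IsAlgClosed k] [CharZero k] {n : Type*} [Fintype n] [DecidableEq n]
variable {ι X Y : Type*} [AddCommGroup X] [AddCommGroup Y] [Fintype ι] [DecidableEq ι]
variable {G T : Subgroup (GL n k)} [IsMulCommutative ↥T]
variable {P : RootPairing ι ℤ X Y} {eX : Additive ↥(characterLattice T) ≃+ X}
  {eY : Additive ↥(cocharacterLattice T) ≃+ Y}
variable (hG : IsConnectedReductive G) (hT : IsMaximalTorusIn T G) (h : IsRootDatumOf G T P eX eY)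

omit [IsAlgClosed k] [CharZero k] in
/-- Membership in an eigenspace of `Matrix.toLin' Z`, in `mulVec` form (Mathlib
`Module.End.mem_eigenspace_iff`). [folklore] -/
lemma mem_eigenspace_toLin'_iff {Z : Matrix n n k} {c : k} {v : n → k} :
    v ∈ Module.End.eigenspace (Matrix.toLin' Z) c ↔ Z.mulVec v = c • v := by
  rw [Module.End.mem_eigenspace_iff, Matrix.toLin'_apply]

omit [IsMulCommutative ↥T] in
/-- **A semisimple element of `Lie(T)` whose trace vanishes on each of its (`G`-stable) eigenspaces is
zero**; more precisely: if `Z ∈ Lie(T)` (`T` a torus) has `dim W_c · c = 0` for every eigenvalue `c`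
with eigenspace `W_c`, then `Z = 0`. Stated with the hypothesis in the form produced by the trace
functionals of stable subspaces. [folklore] -/
theorem eq_zero_of_mem_lieAlgebraGL_torus_of_forall_eigenspace (hTt : IsTorusSubgroup T) {Z : Matrix n n k}
    (hZ : Z ∈ lieAlgebraGL T)
    (htr : ∀ c : k, Module.End.eigenspace (Matrix.toLin' Z) c ≠ ⊥ →
      (StableDet.restrMat (Module.End.eigenspace (Matrix.toLin' Z) c) Z).trace = 0) : Z = 0 := by
  obtain ⟨A, hA⟩ := exists_conj_le_diagonalSubgroup hTt.2.1 hTt.2.2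
  have hD := conj_mem_lieAlgebraGL_map_conj A hZ
  obtain ⟨d, hd⟩ := exists_eq_diagonal_of_mem_lieAlgebraGL hA hD
  -- `Z = A⁻¹ diag(d) A`, so `A⁻¹ e_i` is an eigenvector for `d i`
  have hZ' : Z = ((A⁻¹ : GL n k) : Matrix n n k) * Matrix.diagonal d * (A : Matrix n n k) := by
    rw [← hd]; simp [Matrix.mul_assoc]
  have hev : ∀ i, ((A⁻¹ : GL n k) : Matrix n n k).mulVec (Pi.single i 1) ∈ Module.End.eigenspace (Matrix.toLin' Z) (d i) := by
    intro i
    rw [mem_eigenspace_toLin'_iff, hZ', Matrix.mulVec_mulVec, Matrix.mul_assoc, Units.mul_inv, Matrix.mul_one,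
      ← Matrix.mulVec_mulVec, Matrix.diagonal_mulVec_single, mul_one,
      show (Pi.single i (d i) : n → k) = d i • (Pi.single i (1 : k) : n → k) by
        rw [← Pi.single_smul, smul_eq_mul, mul_one],
      Matrix.mulVec_smul]
  have hne : ∀ i, ((A⁻¹ : GL n k) : Matrix n n k).mulVec (Pi.single i 1) ≠ 0 := by
    intro i h0
    have := congrArg ((A : Matrix n n k).mulVec) h0
    rw [Matrix.mulVec_mulVec, Units.mul_inv, Matrix.one_mulVec, Matrix.mulVec_zero] at this
    exact (one_ne_zero (α := k)) (by simpa using congrFun this i)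
  -- each eigenvalue vanishes
  have hd0 : ∀ i, d i = 0 := by
    intro i
    have hbot : Module.End.eigenspace (Matrix.toLin' Z) (d i) ≠ ⊥ := fun hbot => hne i (by
      have := hev i; rw [hbot, Submodule.mem_bot] at this; exact this)
    have h1 := htr (d i) hbot
    rw [StableDet.trace_restrMat_of_forall_eq_smul (Module.End.eigenspace (Matrix.toLin' Z) (d i))
      (fun w hw => mem_eigenspace_toLin'_iff.1 hw)] at h1
    rcases mul_eq_zero.1 h1 with h2 | h2
    · exfalso
      have hfin : Module.finrank k ↥(Module.End.eigenspace (Matrix.toLin' Z) (d i)) ≠ 0 := by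
        rwa [Ne, Submodule.finrank_eq_zero]
      exact hfin (by exact_mod_cast h2)
    · exact h2
  have : Matrix.diagonal d = 0 := by
    rw [show d = 0 from funext hd0]; exact Matrix.diagonal_zero
  rw [hZ', this, Matrix.mul_zero, Matrix.zero_mul]

include hG hT h in
omit [Fintype ι] [DecidableEq ι] in
/-- **An element of `𝔷` whose trace vanishes on every `G`-stable subspace is zero.**
[cite: SpringerLAG1998, 8.1.8] -/
theorem eq_zero_of_mem_torusCenter_of_forall_trace {Z : Matrix n n k} (hZ : Z ∈ torusCenter T eX P)
    (htr : ∀ W : Submodule k (n → k), (∀ g ∈ G, StableDet.Stab W ((g : GL n k) : Matrix n n k)) →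
      (StableDet.restrMat W Z).trace = 0) : Z = 0 := by
  refine eq_zero_of_mem_lieAlgebraGL_torus_of_forall_eigenspace hT.2.1 hZ.1 fun c _ => htr _ fun g hg => ?_
  intro w hw
  rw [← Matrix.toLin'_apply]
  exact RootRep.toLin'_mem_eigenspace_of_commute (forall_mul_eq_mul_of_mem_torusCenter hG hT h hZ g hg) c hw

omit [IsAlgClosed k] [CharZero k] in
/-- The trace on a stable subspace of a commutator of stabilising matrices vanishes. [folklore] -/
theorem trace_restrMat_lie_eq_zero (W : Submodule k (n → k)) {A B : Matrix n n k}
    (hA : StableDet.Stab W A) (hB : StableDet.Stab W B) :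
    (StableDet.restrMat W (A * B - B * A)).trace = 0 := by
  rw [sub_eq_add_neg, StableDet.restrMat_add, ← neg_one_smul k (B * A), StableDet.restrMat_smul,
    StableDet.restrMat_mul W hB, StableDet.restrMat_mul W hA, Matrix.trace_add, Matrix.trace_smul,
    Matrix.trace_mul_comm, smul_eq_mul, neg_one_mul, add_neg_cancel]

include hG hT h in
/-- **An `H ∈ Lie(T)` with `tr (H|_W) = 0` for every `G`-stable subspace `W` is a `k`-combination of
the coroot vectors `h_j`.** [cite: SpringerLAG1998, 8.1.8] -/
theorem mem_span_rootH_of_forall_trace_eq_zero {H : Matrix n n k} (hH : H ∈ lieAlgebraGL T)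
    (htr : ∀ W : Submodule k (n → k), (∀ g ∈ G, StableDet.Stab W ((g : GL n k) : Matrix n n k)) →
      (StableDet.restrMat W H).trace = 0) :
    H ∈ Submodule.span k (Set.range h.rootH) := by
  haveI : Infinite k := IsAlgClosed.instInfinite
  obtain ⟨s, c, hc⟩ := exists_sub_mem_torusCenter hG hT h hH
  -- the `h_j = [e_j, f_j]` have trace zero on stable subspaces, hence so does the centre part
  have hZ0 : H - ∑ j ∈ s, c j • h.rootH j = 0 := by
    refine eq_zero_of_mem_torusCenter_of_forall_trace hG hT h hc fun W hW => ?_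
    have e : H - ∑ j ∈ s, c j • h.rootH j = H + (-1 : k) • ∑ j ∈ s, c j • h.rootH j := by
      rw [neg_one_smul, sub_eq_add_neg]
    rw [e, StableDet.restrMat_add, StableDet.restrMat_smul, StableDet.restrMat_sum, Matrix.trace_add,
      Matrix.trace_smul, Matrix.trace_sum, htr W hW, zero_add, smul_eq_zero]
    refine Or.inr (Finset.sum_eq_zero fun j _ => ?_)
    rw [StableDet.restrMat_smul, Matrix.trace_smul, ← h.lie_rootE_rootF j,
      trace_restrMat_lie_eq_zero W
        (fun w hw => mulVec_mem_of_forall_mulVec_mem (fun g hg w hw => hW g hg w hw) (h.rootE_mem j).1 hw)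
        (fun w hw => mulVec_mem_of_forall_mulVec_mem (fun g hg w hw => hW g hg w hw) (h.rootF_mem j).1 hw),
      smul_zero]
  rw [sub_eq_zero] at hZ0
  rw [hZ0]
  exact Submodule.sum_mem _ fun j _ => Submodule.smul_mem _ _ (Submodule.subset_span ⟨j, rfl⟩)

end Traces

end Literature.NumberTheory.Automorphic
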